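import Summits.NavierStokesRegularity.NavierStokesRegularity.Theorems.EfficiencyFloorRigidExitReferenceFlow
import Literature.Analysis.FluidPDE.NormalisedPressureDuality
import HarnessLib

/-!
# Route `EfficiencyFloor`, support `RigidExit` (stmt-NavierStokesRegularity-25513) on the `ProductionEfficiencyDecay`
# ladder (stmt-NavierStokesRegularity-22866): THE REFERENCE FLOW — continuity of its enstrophy at `t = 0⁺`

Helper file (`--supports stmt-NavierStokesRegularity-22866`; line `efficiency_floor`), continuing
`…EfficiencyFloorRigidExitReferenceFlow` (p839713: Leray's reference flow `(v,q)` through an admissible field `m`, with the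
enstrophy budget at interior times). The budget there lives on the OPEN interval `(0,T)`; to compare the reference flow with
near-maximiser slices one needs the enstrophy curve up to `t = 0`. This file proves it is continuous at `0⁺`:

* `tendsto_eLpNorm_two_nhdsGT`, `tendsto_eEnergy_nhdsGT` — `‖v(t)‖_{L²} → ‖m‖_{L²}` as `t → 0⁺` (strong attainment of the
  datum, a field of the tree's `IsLerayHopfOn`);
* `tendsto_enstrophy_nhdsGT` — `∫|curl v(t)|² → ∫|curl m|²` as `t → 0⁺`: `‖v(t)‖²_{H¹} = ‖v(t)‖²_{L²} + Z(v(t))` on `(0,T]`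
  and at `0` (div–curl identity on admissible slices, `ReferenceFlow.eWeakGradL2Sq_eq_ofReal_enstrophy`), the `H¹` norm is
  continuous on `[0,T]` (Leray's package) and the `L²` norm at `0⁺`.
* `inv_sq_sub_inv_sq_le_zero` — consequently rung zero of the cubic law holds FROM `t = 0`: `Z(m)⁻² − Z(v t)⁻² ≤ 2K·t` on
  `[0,T)` whenever the enstrophy stays positive (`K = 27c⁴/(128ν³)` for any admissible Lu–Doering constant `c`).

HONEST FRAMING: classical bookkeeping on the reference flow; `RigidExit`, `NearMaximiserBoundedAmplification`,
`LerayFloorGap`, `ProductionEfficiencyDecay` (stmt-22866) and Navier–Stokes regularity stay OPEN; no summit statement is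
proved. [folklore]
-/

-- the problem directory repeats the summit name (`NavierStokesRegularity/NavierStokesRegularity`)
set_option linter.dupNamespace false

noncomputable section

open Set Filter MeasureTheory Topology Function
open scoped InnerProductSpace RealInnerProductSpace ENNReal NNReal ContDiff
open Literature.Analysis.FluidPDE

namespace Summit.NavierStokesRegularity.NavierStokesRegularity.Theorems

namespace RigidExit

namespace ReferenceFlow

/-! ## §5 The enstrophy curve of the reference flow is continuous at `t = 0⁺` -/

section Continuity

variable {ν T : ℝ} {m : EuclideanSpace ℝ (Fin 3) → EuclideanSpace ℝ (Fin 3)}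
  {v : ℝ → EuclideanSpace ℝ (Fin 3) → EuclideanSpace ℝ (Fin 3)} {q : ℝ → EuclideanSpace ℝ (Fin 3) → ℝ}

/-- **`L²` continuity at `0⁺`**: along a Leray–Hopf solution from `m`, `‖v(t)‖_{L²} → ‖m‖_{L²}` as `t → 0⁺` (the datum is
attained strongly in `L²`). [folklore] -/
theorem tendsto_eLpNorm_two_nhdsGT (hLH : IsLerayHopfOn T ν 0 m v) (hT : 0 < T) (hm : MemLp m 2 volume) :
    Tendsto (fun t => eLpNorm (v t) 2 volume) (𝓝[>] 0) (𝓝 (eLpNorm m 2 volume)) := by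
  have h0 := hLH.strong_initial
  have hmf : eLpNorm m 2 volume ≠ ⊤ := hm.eLpNorm_ne_top
  have hev : ∀ᶠ t in 𝓝[>] (0 : ℝ), t ∈ Ioo 0 T := Ioo_mem_nhdsGT hT
  -- lower and upper bounds by the triangle inequality
  have hlow : ∀ᶠ t in 𝓝[>] (0 : ℝ), eLpNorm m 2 volume - eLpNorm (v t - m) 2 volume ≤ eLpNorm (v t) 2 volume := by
    filter_upwards [hev] with t ht
    have hvt : AEStronglyMeasurable (v t) volume := (hLH.memLp t ⟨ht.1.le, ht.2.le⟩).1
    refine tsub_le_iff_right.2 ?_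
    calc eLpNorm m 2 volume = eLpNorm ((m - v t) + v t) 2 volume := by rw [sub_add_cancel]
      _ ≤ eLpNorm (m - v t) 2 volume + eLpNorm (v t) 2 volume := eLpNorm_add_le (hm.1.sub hvt) hvt (by norm_num)
      _ = eLpNorm (v t) 2 volume + eLpNorm (v t - m) 2 volume := by rw [eLpNorm_sub_comm, add_comm]
  have hup : ∀ᶠ t in 𝓝[>] (0 : ℝ), eLpNorm (v t) 2 volume ≤ eLpNorm (v t - m) 2 volume + eLpNorm m 2 volume := by
    filter_upwards [hev] with t ht
    have hvt : AEStronglyMeasurable (v t) volume := (hLH.memLp t ⟨ht.1.le, ht.2.le⟩).1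
    calc eLpNorm (v t) 2 volume = eLpNorm ((v t - m) + m) 2 volume := by rw [sub_add_cancel]
      _ ≤ eLpNorm (v t - m) 2 volume + eLpNorm m 2 volume := eLpNorm_add_le (hvt.sub hm.1) hm.1 (by norm_num)
  have hl : Tendsto (fun t => eLpNorm m 2 volume - eLpNorm (v t - m) 2 volume) (𝓝[>] 0)
      (𝓝 (eLpNorm m 2 volume)) := by
    have h := ENNReal.Tendsto.sub (tendsto_const_nhds (x := eLpNorm m 2 volume)) h0 (Or.inl hmf)
    rwa [tsub_zero] at h
  have hu : Tendsto (fun t => eLpNorm (v t - m) 2 volume + eLpNorm m 2 volume) (𝓝[>] 0)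
      (𝓝 (eLpNorm m 2 volume)) := by
    have h := h0.add (tendsto_const_nhds (x := eLpNorm m 2 volume))
    rwa [zero_add] at h
  exact tendsto_of_tendsto_of_tendsto_of_le_of_le' hl hu hlow hup

/-- **The extended energy is continuous at `0⁺`**: `∫⁻ ‖v(t)‖ₑ² → ∫⁻ ‖m‖ₑ²`. [folklore] -/
theorem tendsto_eEnergy_nhdsGT (hLH : IsLerayHopfOn T ν 0 m v) (hT : 0 < T) (hm : MemLp m 2 volume) :
    Tendsto (fun t => eEnergy (v t)) (𝓝[>] 0) (𝓝 (eEnergy m)) := by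
  have h := ((ENNReal.continuous_pow 2).tendsto _).comp (tendsto_eLpNorm_two_nhdsGT hLH hT hm)
  simp only [eEnergy, lintegral_enorm_pow_two_eq_eLpNorm_sq]
  exact h

/-- **The enstrophy of the reference flow is continuous at `t = 0⁺`.** For the reference flow `(v,q)` through an
admissible `m` on `[0,T]` (Leray–Hopf from `m`, `v 0 = m`, `H¹`-continuous on `[0,T]`, classical on `(0,T]`, Sobolev norms
bounded on every `[δ,T]`): `∫ ‖curl v(t)‖² → ∫ ‖curl m‖²` as `t → 0⁺`. Proof: `‖v(t)‖²_{H¹} = ‖v(t)‖²_{L²} + Z(v(t))` for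
`t ∈ (0,T]` and at `t = 0` (div–curl identity on admissible slices); the `H¹` norm is continuous on `[0,T]` and the `L²`
norm is continuous at `0⁺` (strong attainment of the datum), so the enstrophy is. [folklore] -/
theorem tendsto_enstrophy_nhdsGT (hT : 0 < T) (hLH : IsLerayHopfOn T ν 0 m v) (hv0 : v 0 = m)
    (hH1 : IsH1RegularOn (Icc 0 T) v) (hcl : IsClassicalNSSolutionOn (Ioc 0 T) ν 0 v q)
    (hB : ∀ δ : ℝ, 0 < δ → δ ≤ T → HasBoundedSobolevNormsOn (Icc δ T) v)
    (hm : ContDiff ℝ (⊤ : ℕ∞) m ∧ VectorCalculus.IsDivFree m ∧ (∫⁻ x, ‖iteratedFDeriv ℝ 0 m x‖ₑ ^ 2 < ⊤) ∧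
      (∫⁻ x, ‖iteratedFDeriv ℝ 1 m x‖ₑ ^ 2 < ⊤) ∧ (∫⁻ x, ‖iteratedFDeriv ℝ 2 m x‖ₑ ^ 2 < ⊤)) :
    Tendsto (fun t => ∫ x, ‖curl (v t) x‖ ^ 2) (𝓝[>] 0) (𝓝 (∫ x, ‖curl m x‖ ^ 2)) := by
  obtain ⟨hsm, hdiv, h0, h1, h2⟩ := hm
  have hm2 : MemLp m 2 volume := memLp_two_of_admissible hsm h0
  -- `H¹` continuity at `0` within `[0,T]`, hence within `(0, ∞)`
  have hIcc : Icc 0 T ∈ 𝓝[>] (0 : ℝ) := mem_of_superset (Ioo_mem_nhdsGT hT) Ioo_subset_Icc_self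
  have hH : Tendsto (fun t => eH1NormSq (v t)) (𝓝[>] 0) (𝓝 (eH1NormSq m)) := by
    have hc : ContinuousWithinAt (fun t => eH1NormSq (v t)) (Icc 0 T) 0 := hH1.2 0 ⟨le_rfl, hT.le⟩
    rw [ContinuousWithinAt, hv0] at hc
    exact hc.mono_left (nhdsWithin_le_of_mem hIcc)
  have hE := tendsto_eEnergy_nhdsGT hLH hT hm2
  -- finiteness at `m`
  have hEm : eEnergy m ≠ ⊤ := by
    rw [eEnergy, lintegral_enorm_pow_two_eq_eLpNorm_sq]
    exact ENNReal.pow_ne_top hm2.eLpNorm_ne_top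
  have hHm : eH1NormSq m ≠ ⊤ := by
    have h := hH1.1 0 ⟨le_rfl, hT.le⟩
    rw [hv0] at h
    exact h.ne
  -- the weak dissipation as a difference, and its limit
  have hD : Tendsto (fun t => eH1NormSq (v t) - eEnergy (v t)) (𝓝[>] 0) (𝓝 (eH1NormSq m - eEnergy m)) :=
    ENNReal.Tendsto.sub hH hE (Or.inl hHm)
  have hsub : ∀ w : EuclideanSpace ℝ (Fin 3) → EuclideanSpace ℝ (Fin 3), eEnergy w ≠ ⊤ →
      eH1NormSq w - eEnergy w = eWeakGradL2Sq w := fun w hw => by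
    rw [eH1NormSq_def, ENNReal.add_sub_cancel_left hw]
  rw [hsub m hEm, eWeakGradL2Sq_eq_ofReal_enstrophy hsm hdiv h0 h1 h2] at hD
  -- identify along `(0,T]`
  have hev : ∀ᶠ t in 𝓝[>] (0 : ℝ), t ∈ Ioo 0 T := Ioo_mem_nhdsGT hT
  have hD' : Tendsto (fun t => ENNReal.ofReal (∫ x, ‖curl (v t) x‖ ^ 2)) (𝓝[>] 0)
      (𝓝 (ENNReal.ofReal (∫ x, ‖curl m x‖ ^ 2))) := by
    refine hD.congr' ?_
    filter_upwards [hev] with t ht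
    obtain ⟨hst, hdt, h0t, h1t, h2t⟩ := slice_admissible hcl hB ⟨ht.1, ht.2.le⟩
    have hEt : eEnergy (v t) ≠ ⊤ := by
      rw [eEnergy, lintegral_enorm_pow_two_eq_eLpNorm_sq]
      exact ENNReal.pow_ne_top (memLp_two_of_admissible hst h0t).eLpNorm_ne_top
    rw [hsub (v t) hEt, eWeakGradL2Sq_eq_ofReal_enstrophy hst hdt h0t h1t h2t]
  -- back to real numbers
  have hZm : 0 ≤ ∫ x, ‖curl m x‖ ^ 2 := integral_nonneg fun x => by positivity
  have h := (ENNReal.tendsto_toReal ENNReal.ofReal_ne_top).comp hD'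
  rw [ENNReal.toReal_ofReal hZm] at h
  refine h.congr' (Eventually.of_forall fun t => ?_)
  simp only [Function.comp_apply]
  exact ENNReal.toReal_ofReal (integral_nonneg fun x => by positivity)

/-- **Rung zero from `t = 0` along the reference flow.** For the reference flow `(v,q)` through an admissible `m` with
`Z(m) > 0` whose enstrophy stays positive on `(0,T)`, and any one-sided admissible Lu–Doering constant `c`:
`Z(m)⁻² − Z(v t)⁻² ≤ 2·(27c⁴/(128ν³))·t` for every `t ∈ [0,T)` — the integrated cubic law started AT the datum (interior rung
zero `ReferenceFlow.inv_sq_sub_inv_sq_le` + continuity of the enstrophy at `0⁺`). In particular the reference flow's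
enstrophy cannot blow up before the window `W = (64ν³/(27c⁴))·Z(m)⁻²`. [cite: LuDoering2008, eq. (6)] -/
theorem inv_sq_sub_inv_sq_le_zero (hν : 0 < ν) (hT : 0 < T) (hLH : IsLerayHopfOn T ν 0 m v) (hv0 : v 0 = m)
    (hH1 : IsH1RegularOn (Icc 0 T) v) (hcl : IsClassicalNSSolutionOn (Ioc 0 T) ν 0 v q)
    (hB : ∀ δ : ℝ, 0 < δ → δ ≤ T → HasBoundedSobolevNormsOn (Icc δ T) v)
    (hm : ContDiff ℝ (⊤ : ℕ∞) m ∧ VectorCalculus.IsDivFree m ∧ (∫⁻ x, ‖iteratedFDeriv ℝ 0 m x‖ₑ ^ 2 < ⊤) ∧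
      (∫⁻ x, ‖iteratedFDeriv ℝ 1 m x‖ₑ ^ 2 < ⊤) ∧ (∫⁻ x, ‖iteratedFDeriv ℝ 2 m x‖ₑ ^ 2 < ⊤))
    {c : ℝ}
    (hc : ∀ w : EuclideanSpace ℝ (Fin 3) → EuclideanSpace ℝ (Fin 3), (ContDiff ℝ (⊤ : ℕ∞) w ∧
      VectorCalculus.IsDivFree w ∧ (∫⁻ x, ‖iteratedFDeriv ℝ 0 w x‖ₑ ^ 2 < ⊤) ∧
      (∫⁻ x, ‖iteratedFDeriv ℝ 1 w x‖ₑ ^ 2 < ⊤) ∧ (∫⁻ x, ‖iteratedFDeriv ℝ 2 w x‖ₑ ^ 2 < ⊤)) →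
      (∫ x, ⟪curl w x, fderiv ℝ w x (curl w x)⟫_ℝ) ≤ c * (∫ x, ‖curl w x‖ ^ 2) ^ (3 / 4 : ℝ) *
        (∫ x, frobeniusNormSq (fderiv ℝ (curl w) x)) ^ (3 / 4 : ℝ))
    (hZm : 0 < ∫ x, ‖curl m x‖ ^ 2) (hpos : ∀ τ ∈ Ioo 0 T, 0 < ∫ x, ‖curl (v τ) x‖ ^ 2)
    {t : ℝ} (ht : t ∈ Ico 0 T) :
    (∫ x, ‖curl m x‖ ^ 2)⁻¹ ^ 2 - (∫ x, ‖curl (v t) x‖ ^ 2)⁻¹ ^ 2 ≤ 2 * (27 * c ^ 4 / (128 * ν ^ 3)) * t := by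
  rcases ht.1.eq_or_lt with h0 | h0
  · subst h0; rw [hv0]; simp
  -- for `0 < s ≤ t`: `Z(v s)⁻² − Z(v t)⁻² ≤ 2K (t − s)`; let `s → 0⁺`
  set K : ℝ := 27 * c ^ 4 / (128 * ν ^ 3) with hK
  have hle : ∀ᶠ s in 𝓝[>] (0 : ℝ), (∫ x, ‖curl (v s) x‖ ^ 2)⁻¹ ^ 2 - (∫ x, ‖curl (v t) x‖ ^ 2)⁻¹ ^ 2 ≤
      2 * K * (t - s) := by
    filter_upwards [Ioo_mem_nhdsGT h0] with s hs
    exact inv_sq_sub_inv_sq_le hν hcl hB hc hs.1 (fun τ hτ => hpos τ ⟨hs.1.trans_le hτ.1, hτ.2⟩) le_rfl hs.2.le ht.2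
  have hZ := tendsto_enstrophy_nhdsGT hT hLH hv0 hH1 hcl hB hm
  have hf : Tendsto (fun s => (∫ x, ‖curl (v s) x‖ ^ 2)⁻¹ ^ 2 - (∫ x, ‖curl (v t) x‖ ^ 2)⁻¹ ^ 2) (𝓝[>] 0)
      (𝓝 ((∫ x, ‖curl m x‖ ^ 2)⁻¹ ^ 2 - (∫ x, ‖curl (v t) x‖ ^ 2)⁻¹ ^ 2)) :=
    ((hZ.inv₀ hZm.ne').pow 2).sub tendsto_const_nhds
  have hg : Tendsto (fun s : ℝ => 2 * K * (t - s)) (𝓝[>] 0) (𝓝 (2 * K * t)) := by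
    have h : Tendsto (fun s : ℝ => 2 * K * (t - s)) (𝓝 0) (𝓝 (2 * K * (t - 0))) :=
      ((continuous_const.mul (continuous_const.sub continuous_id)).tendsto 0)
    rw [sub_zero] at h
    exact h.mono_left nhdsWithin_le_nhds
  exact le_of_tendsto_of_tendsto hf hg hle

end Continuity

end ReferenceFlow

end RigidExit

end Summit.NavierStokesRegularity.NavierStokesRegularity.Theorems

end
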